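import Mathlib
import Summits.NavierStokesRegularity.NavierStokesRegularity.Theorems.EulerZoomLiouvillePowerGaugeEulerLiouvilleSelfSimilarPastStrata
import HarnessLib

/-!
# Members of crux E with an IRROTATIONAL INCOMPRESSIBLE `C²` PAST are trivial — no self-similarity, no classical-solution structure,
# no growth hypothesis (crux `EulerZoomLiouville.PowerGaugeEulerLiouville` = stmt-NavierStokesRegularity-19832, line `birth`, stub 5)

Route `EulerZoomLiouville` (NavierStokesRegularity).  Interim LEAD ns-typeII-p2 g9.  A three-line stratum of `stub_nonSelfSimilarRest` obtained by combining
two endgames already in the tree: if on some past sub-slab `τ < T₁` (`T₁ ≤ 0`) every slice `u(τ)` is `C²`, divergence free and IRROTATIONAL, then each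
such slice has harmonic components (`laplacian_eq_zero_of_curl_eq_zero_of_isDivFree`), the member's OWN `A`-gauge read on that slice gives the sub-volume
growth `∫_{B_a}‖u(τ)‖² ≤ c a^{1−2ρ}` for `a² > −τ` (all scales by continuity), so the slice VANISHES (`Loc.eq_zero_of_curl_eq_zero_of_growth` ←
`HarmonicOnNhd.eq_zero_of_lintegral_sq_le`, `Literature/…/HarmonicLiouvilleGrowth`); hence the past is energy-quiescent and the crux's filled energy
stratum `ae_eq_zero_of_gauge_of_energyVanishing_allRho` (`stub_quiescentPast`) kills the member on the WHOLE slab — whatever it does on `[T₁, 0)`.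
Strictly contains ns-typeII-p1 g8's `KelvinPhysical.ae_eq_zero_of_gauge_of_classical_irrotational` (`T₁ = 0`, classical Euler solution on the
past) and needs neither the classical-solution structure nor the identification of the weak gradient.

* `PastIrrotational.slice_eq_zero_of_gaugeA` — one slice: `τ < 0`, `u(τ) ∈ C²`, `div u(τ) = 0`, `curl u(τ) ≡ 0`, `A`-gauge ⇒ `u(τ) = 0`;
* `PastIrrotational.ae_eq_zero_of_gauge_of_pastIrrotational` — MEMBER LEVEL, crux hypotheses verbatim (`ρ > 0`): irrotational incompressible `C²`
  slices for all `τ < T₁` (`T₁ ≤ 0`) ⇒ `u = 0` a.e. on `(−∞,0) × ℝ³`.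

WHAT THIS IS NOT: not NS, not E — a stratum `--supports` stmt-19832; members whose every far-past slice carries vorticity remain (the generic case).
[folklore; GilbargTrudinger2001 Thm 2.1 (mean value)]
-/

noncomputable section

-- flat `Theorems/<Route><Decl>…` files of one crux share the namespace of the crux (tree convention: `Summit.<S>.<S>.…`)
set_option linter.dupNamespace false

open MeasureTheory Set Filter Topology Metric Function InnerProductSpace TopologicalSpace
open scoped RealInnerProductSpace NNReal ENNReal ContDiff

namespace Summit.NavierStokesRegularity.NavierStokesRegularity.Theorems.PowerGaugeEulerLiouville

open Literature.Analysis Literature.Analysis.FunctionSpaces Literature.Analysis.FluidPDE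

namespace PastIrrotational

variable {u : ℝ → EuclideanSpace ℝ (Fin 3) → EuclideanSpace ℝ (Fin 3)} {p : ℝ → EuclideanSpace ℝ (Fin 3) → ℝ}
  {H : ℝ → EuclideanSpace ℝ (Fin 3) → EuclideanSpace ℝ (Fin 3) →L[ℝ] EuclideanSpace ℝ (Fin 3)} {c : ℝ≥0}

/-- **An irrotational incompressible `C²` slice of a member with the `A`-gauge VANISHES** (`ρ > 0`, `τ < 0`): the gauge on the slice `τ` at every
radius `a` with `a² > −τ` gives `∫_{B_a}‖u(τ)‖² ≤ c a^{1−2ρ}`, small balls are handled by continuity (`Shifted.growth_of_growth_le`), and the growth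
form of Liouville's theorem for the harmonic components concludes (`Loc.eq_zero_of_curl_eq_zero_of_growth`). [folklore] -/
theorem slice_eq_zero_of_gaugeA {ρ : ℝ} (hρ : 0 < ρ) (hρ3 : ρ ≤ 1 / 2)
    (hA : ∀ a : ℝ, 0 < a → ENNReal.ofReal (a ^ (2 * ρ)) *
      cknA a (0 : ℝ × EuclideanSpace ℝ (Fin 3)) u ≤ (c : ℝ≥0∞))
    {τ : ℝ} (hτ : τ < 0) (hC2 : ContDiff ℝ 2 (u τ)) (hdiv : VectorCalculus.IsDivFree (u τ))
    (hcurl : ∀ x, curl (u τ) x = 0) : u τ = 0 := by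
  -- the `A`-gauge on the slice `τ` at every radius `a ≥ L₀ := √(−τ) + 1`
  set L₀ : ℝ := Real.sqrt (-τ) + 1 with hL₀
  have hL₀1 : 1 ≤ L₀ := by rw [hL₀]; linarith [Real.sqrt_nonneg (-τ)]
  have hlarge : ∀ a : ℝ, L₀ ≤ a →
      ∫⁻ x in ball (0 : EuclideanSpace ℝ (Fin 3)) a, ‖u τ x‖ₑ ^ 2 ≤ (c : ℝ≥0∞) * ENNReal.ofReal (a ^ (1 - 2 * ρ)) := by
    intro a ha
    have ha0 : 0 < a := by linarith
    have hsq : Real.sqrt (-τ) ^ 2 = -τ := Real.sq_sqrt (by linarith)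
    have ha2 : -τ < a ^ 2 := by nlinarith [Real.sqrt_nonneg (-τ)]
    have hτI : τ ∈ Ioo ((0 : ℝ × EuclideanSpace ℝ (Fin 3)).1 - a ^ 2) (0 : ℝ × EuclideanSpace ℝ (Fin 3)).1 := by
      simp only [Prod.fst_zero, zero_sub, mem_Ioo]
      exact ⟨by linarith, hτ⟩
    have hslice : (ENNReal.ofReal a)⁻¹ * ∫⁻ x in ball (0 : EuclideanSpace ℝ (Fin 3)) a, ‖u τ x‖ₑ ^ 2 ≤
        cknA a (0 : ℝ × EuclideanSpace ℝ (Fin 3)) u := by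
      unfold cknA
      exact le_iSup₂ (f := fun t (_ : t ∈ Ioo ((0 : ℝ × EuclideanSpace ℝ (Fin 3)).1 - a ^ 2)
          (0 : ℝ × EuclideanSpace ℝ (Fin 3)).1) =>
          (ENNReal.ofReal a)⁻¹ * ∫⁻ x in ball (0 : ℝ × EuclideanSpace ℝ (Fin 3)).2 a, ‖u t x‖ₑ ^ 2) τ hτI
    set I : ℝ≥0∞ := ∫⁻ x in ball (0 : EuclideanSpace ℝ (Fin 3)) a, ‖u τ x‖ₑ ^ 2 with hI
    have hgauge : ENNReal.ofReal (a ^ (2 * ρ)) * ((ENNReal.ofReal a)⁻¹ * I) ≤ (c : ℝ≥0∞) :=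
      calc ENNReal.ofReal (a ^ (2 * ρ)) * ((ENNReal.ofReal a)⁻¹ * I)
          ≤ ENNReal.ofReal (a ^ (2 * ρ)) * cknA a (0 : ℝ × EuclideanSpace ℝ (Fin 3)) u := by gcongr
        _ ≤ (c : ℝ≥0∞) := hA a ha0
    have hKa : ENNReal.ofReal (a ^ (2 * ρ)) * (ENNReal.ofReal a)⁻¹ = ENNReal.ofReal (a ^ (2 * ρ - 1)) := by
      rw [← ENNReal.ofReal_inv_of_pos ha0, ← ENNReal.ofReal_mul (by positivity), Real.rpow_sub_one ha0.ne',
        div_eq_mul_inv]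
    have hunit : ENNReal.ofReal (a ^ (1 - 2 * ρ)) * ENNReal.ofReal (a ^ (2 * ρ - 1)) = 1 := by
      rw [← ENNReal.ofReal_mul (by positivity), ← Real.rpow_add ha0, show (1 - 2 * ρ) + (2 * ρ - 1) = 0 by ring,
        Real.rpow_zero, ENNReal.ofReal_one]
    calc I = ENNReal.ofReal (a ^ (1 - 2 * ρ)) * (ENNReal.ofReal (a ^ (2 * ρ - 1)) * I) := by
          rw [← mul_assoc, hunit, one_mul]
      _ = ENNReal.ofReal (a ^ (1 - 2 * ρ)) * (ENNReal.ofReal (a ^ (2 * ρ)) * ((ENNReal.ofReal a)⁻¹ * I)) := by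
          rw [← mul_assoc (ENNReal.ofReal (a ^ (2 * ρ))), hKa]
      _ ≤ ENNReal.ofReal (a ^ (1 - 2 * ρ)) * (c : ℝ≥0∞) := by gcongr
      _ = (c : ℝ≥0∞) * ENNReal.ofReal (a ^ (1 - 2 * ρ)) := mul_comm _ _
  -- all scales by continuity, then the growth-form Liouville for the harmonic components
  obtain ⟨C', hC', hgrowth'⟩ := Shifted.growth_of_growth_le hC2.continuous (θ := 1 - 2 * ρ) (by linarith) hL₀1
    ENNReal.coe_ne_top hlarge
  exact Loc.eq_zero_of_curl_eq_zero_of_growth hC2 hcurl hdiv hC' (θ := 1 - 2 * ρ) (by linarith) hgrowth'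

/-- **A MEMBER WITH AN IRROTATIONAL INCOMPRESSIBLE `C²` PAST IS TRIVIAL** (crux hypotheses verbatim, `0 < ρ ≤ ½`): if for some `T₁ ≤ 0` every slice
`u(τ)`, `τ < T₁`, is `C²`, divergence free and irrotational, then `u = 0` a.e. on `(−∞,0) × ℝ³` — each such slice vanishes by
`slice_eq_zero_of_gaugeA`, so the past is energy-quiescent and `ae_eq_zero_of_gauge_of_energyVanishing_allRho` (`stub_quiescentPast`) applies.  No
self-similarity, no classical-solution structure, nothing on `[T₁, 0)`. [folklore] -/
theorem ae_eq_zero_of_gauge_of_pastIrrotational {ρ : ℝ} (hρ : 0 < ρ) (hρ3 : ρ ≤ 1 / 2)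
    (hsw : IsSuitableWeakSolutionOn (slab (EuclideanSpace ℝ (Fin 3)) (Iio 0) isOpen_Iio) 0 0 u p)
    (hH : HasWeakSpatialGradientOn (slab (EuclideanSpace ℝ (Fin 3)) (Iio 0) isOpen_Iio) u H)
    (hgauge : ∀ a : ℝ, 0 < a →
      ENNReal.ofReal (a ^ (2 * ρ)) * cknA a (0 : ℝ × EuclideanSpace ℝ (Fin 3)) u +
          ENNReal.ofReal (a ^ ρ) * cknE a (0 : ℝ × EuclideanSpace ℝ (Fin 3)) H +
        ENNReal.ofReal (a ^ (2 * ρ)) * cknD a (0 : ℝ × EuclideanSpace ℝ (Fin 3)) p ≤ (c : ℝ≥0∞))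
    {T₁ : ℝ} (hT₁ : T₁ ≤ 0) (hC2 : ∀ τ : ℝ, τ < T₁ → ContDiff ℝ 2 (u τ))
    (hdiv : ∀ τ : ℝ, τ < T₁ → VectorCalculus.IsDivFree (u τ)) (hcurl : ∀ τ : ℝ, τ < T₁ → ∀ x, curl (u τ) x = 0) :
    uncurry u =ᵐ[volume.restrict (Iio (0 : ℝ) ×ˢ (univ : Set (EuclideanSpace ℝ (Fin 3))))] 0 := by
  have hA : ∀ a : ℝ, 0 < a → ENNReal.ofReal (a ^ (2 * ρ)) *
      cknA a (0 : ℝ × EuclideanSpace ℝ (Fin 3)) u ≤ (c : ℝ≥0∞) :=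
    fun a ha => le_trans (le_trans le_self_add le_self_add) (hgauge a ha)
  have hzero : ∀ τ : ℝ, τ < T₁ → u τ = 0 := fun τ hτ =>
    slice_eq_zero_of_gaugeA hρ hρ3 hA (by linarith) (hC2 τ hτ) (hdiv τ hτ) (hcurl τ hτ)
  refine ae_eq_zero_of_gauge_of_energyVanishing_allRho hρ.le hsw hH hgauge fun ε hε N => ?_
  have hsub : Iio (min (-N) T₁) ⊆ {s : ℝ | s < -N ∧ ∫⁻ x, ‖u s x‖ₑ ^ 2 ≤ ENNReal.ofReal ε} := by
    intro s hs
    rw [mem_Iio, lt_min_iff] at hs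
    refine ⟨hs.1, ?_⟩
    simp [hzero s hs.2]
  have hinf : volume (Iio (min (-N) T₁)) = (⊤ : ℝ≥0∞) := Real.volume_Iio
  intro h0
  have := measure_mono_null hsub h0
  rw [hinf] at this
  exact ENNReal.top_ne_zero this

end PastIrrotational

end Summit.NavierStokesRegularity.NavierStokesRegularity.Theorems.PowerGaugeEulerLiouville

end
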